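import Summits.QuantumFields.BalabanUV.Beta.FP.CoarseCovarianceEllipticBound
import Summits.QuantumFields.BalabanUV.Beta.GAN24.PushSumSymbol
import Summits.QuantumFields.BalabanUV.Beta.GAN24.AliasWeightsClosedForm

/-!
# `BalabanUV.Beta.FP.ResidualModeSymbols` — road «FP» (binder row D1), row H′2-IR ∕ IR-3 «IR-3-SYM»: the two SYMBOL-LEVEL LETTERS (P1), (P2) of the owner's
# `IR3-DESIGN.md` §0 that the residual-mode ellipticity IR-3-ELL consumes — (P1) the perfect BF propagator symbol acts on the PURE-GAUGE direction as
# `P̂(s)·p̂ = p̂∕|p̂|²` and splits as `P̂ = P̂^T + p̂p̂†∕|p̂|⁴` with `P̂^T p̂ = 0`, `Re v†P̂^T v = maxwellQ(P̂v) ≥ 0`; (P2) IN SYMBOLS «the contour average of an exact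
# 1-form is the coarse difference of the block mean»: `cweight n μ k · (e^{ik_μ} − 1) = (Π_i gsum (k_i) n) · (e^{i n k_μ} − 1)`, at an alias momentum `e^{i n (k_l)_μ} = e^{iP_μ}`

NOT IN PRINT; OUR BOOKKEEPING ([folklore] matrix algebra + geometric sums), offered to the road-FP OWNER d1-p3-g5 as «IR-3-SYM» (journal l.22088; IR3-DESIGN §0 (P1)∕(P2), §2
«`w·d̂(k_l) = w′(k_l)·d̂^c(k)` IS (P2) in symbols», the transverse part `P̂^T ≥ 0` behind `V_N = QP̂^TQᵀ ≥ 0` in (I3)∕(I4)); it does NOT touch IR-2 (ii)∕(iv) (leaf-06) nor the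
`m_B ≥ c₀` assembly (IR-3-ELL proper).  Inputs BY NAME: `PerfectPropagatorSymbol` (`curlRow`, `sum_curlRow_mul`, `maxwellMat`, `feynMat`, `PinfSym`, `feynMat_isHermitian`,
`PinfSym_mul_feynMat`, `feynMat_mul_PinfSym`, `quad_feynMat`), `PerfectMaxwellSymbol.maxwellQ_nonneg`∕`maxwellQ_W166Inf_nonneg`, `PerfectPropagatorBound.sum_norm_sq_pos`,
leaf-17∕road-P1 `AliasWeights.geomExp_mul_sub_one`, `AliasWeightsClosedForm.two_div_pi_mul_le_norm_geomExp`, `AliasWeights.norm_geomExp_le`, `PushSumSymbol.cweight`,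
`AliasDecimate.aliasPt`.

## What is proved (`0 sorry`, every `d`; `s ∈ BZ (d+1)` real momentum, `ph ≠ 0` momentum factors where stated)
* §1 (P1) [folklore]∕[our object]: `maxwellMat_mulVec_self` (`maxwellMat W ph *ᵥ ph = 0`), `feynMat_mulVec_self` (`feynMat W ph *ᵥ ph = (Σ‖ph‖²)·ph`), **`PinfSym_mulVec_self`**
  (`PinfSym s ph *ᵥ ph = (Σ‖ph‖²)⁻¹·ph`), `PinfSym_isHermitian`, `star_vecMul_PinfSym_self` (the row form), `dotProduct_feynMat_mulVec_self`
  (`star ph ⬝ᵥ (F *ᵥ w) = (Σ‖ph‖²)·(star ph ⬝ᵥ w)`), **`re_quad_PinfSym_eq_maxwellQ_add`** (`Re v†P̂v = maxwellQ W ph (P̂v) + ‖ph†v‖²∕(Σ‖ph‖²)²` — the TRANSVERSE SPLIT in form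
  currency), **`re_quad_PinfSym_sub_gauge_nonneg`** (`0 ≤ Re v†P̂v − ‖ph†v‖²∕(Σ‖ph‖²)²`, i.e. `P̂^T ≥ 0`), `re_quad_PinfSym_ge_gauge` (`Re v†P̂v ≥ ‖ph†v‖²∕(Σ‖ph‖²)²`).
* §2 (P2) [folklore]: `cweight_eq_prod_mul` (`cweight n μ k = (Π_i gsum (k_i) n)·gsum (k_μ) n`, rfl), **`cweight_mul_dhat`** (`cweight n μ k·(e^{ik_μ} − 1) = (Π_i gsum (k_i) n)·(e^{ik_μ n} − 1)`),
  `cexp_aliasPt_mul` (`e^{i (k_l)_μ n} = e^{iP_μ}` at `k_l = aliasPt n l P`), **`cweight_mul_dhat_aliasPt`** (`cweight n μ (k_l)·(e^{i(k_l)_μ} − 1) = (Π_i gsum ((k_l)_i) n)·(e^{iP_μ} − 1)`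
  — «`Q d = d^c Q′`» alias term by alias term).
* §3 [folklore] the block-mean weight at the `l = 0` alias momentum: `norm_prod_gsum_apt_zero_ge` (`(2n∕π)^{d+1} ≤ ‖Π_i gsum (k_i∕n) n‖`, `k ∈ BZ`), `norm_prod_gsum_ofReal_le` (`≤ n^{d+1}`).
HONEST FRAMING: symbol identities for the cell's own U = 1 objects; 0 estimates of Bałaban's objects; 0∕4 row-D1 binders; NOT D1, NOT BetaPertH, NOT the continuum limit, NOT Clay.
HONEST DEPENDENCY (verbatim): «continuum YM on T⁴ ⇐ BetaPertH ∧ nine spine estimates (0/9 proved); BetaPertH ⇐ (D1) ∧ (D4) ∧ CAP+tail; G-an2-4 gates asym, D1 and NE2/3/4.»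
ABSOLUTE RULE respected: no cited fact, no `def`, no `def … : Prop`, nothing of the manuscripts asserted.
Provenance: D1 formalisation swarm leaf prover 02, gen 7 (prover-b2b-balaban-beta-d1-formalise-leaf-02-g7-0), road-FP «IR-3-SYM» offer (journal l.22088), 2026-08-20.
-/

noncomputable section

open Complex Finset Matrix
open scoped Real BigOperators ComplexConjugate
open Literature.MathematicalPhysics.QuantumFieldTheory.Balaban1983to89
open B4Strip (ofRealVec)
open B4ContourShift (BZ)
open Summit.QuantumFields.BalabanUV.Beta.GAN24.FibreSymbols (gsum)
open Summit.QuantumFields.BalabanUV.Beta.GAN24.AliasTiling (apt)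
open Summit.QuantumFields.BalabanUV.Beta.GAN24.AliasDecimate (aliasPt)
open Summit.QuantumFields.BalabanUV.Beta.GAN24.AliasWeights (geomExp_mul_sub_one norm_geomExp_le)
open Summit.QuantumFields.BalabanUV.Beta.GAN24.AliasWeightsClosedForm (two_div_pi_mul_le_norm_geomExp)
open Summit.QuantumFields.BalabanUV.Beta.GAN24.PushSumSymbol (cweight)
open Summit.QuantumFields.BalabanUV.Beta.FP.PerfectSymbol166 (W166Inf)
open Summit.QuantumFields.BalabanUV.Beta.FP.PerfectMaxwellSymbol (maxwellQ maxwellQ_W166Inf_nonneg)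
open Summit.QuantumFields.BalabanUV.Beta.FP.PerfectPropagatorSymbol (curlRow sum_curlRow_mul maxwellMat feynMat quad PinfSym quad_eq_dotProduct quad_feynMat
  feynMat_isHermitian feynMat_mul_PinfSym PinfSym_mul_feynMat)
open Summit.QuantumFields.BalabanUV.Beta.FP.CoarseCovarianceElliptic (star_dotProduct_self star_dotProduct_mulVec_hermitian)
open Summit.QuantumFields.BalabanUV.Beta.FP.CoarseCovarianceEllipticBound (apt_zero_apply)

namespace Summit.QuantumFields.BalabanUV.Beta.FP.ResidualModeSymbols

variable {d : ℕ}

/-! ## §1 (P1) in symbols: the pure-gauge direction and the transverse split of the perfect BF propagator symbol -/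

/-- [folklore] **PURE GAUGES ARE NULL for the weighted Maxwell matrix**: `maxwellMat W ph *ᵥ ph = 0` (`Σ_β curlRow β · ph β = ph μ ph ν − ph ν ph μ = 0`). -/
theorem maxwellMat_mulVec_self (W : Fin (d + 1) → Fin (d + 1) → ℝ) (ph : Fin (d + 1) → ℂ) : maxwellMat W ph *ᵥ ph = 0 := by
  funext α
  simp only [mulVec, dotProduct, maxwellMat, Pi.zero_apply]
  simp_rw [Finset.sum_mul]
  rw [Finset.sum_comm]
  refine Finset.sum_eq_zero fun μ _ => ?_
  rw [Finset.sum_comm]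
  refine Finset.sum_eq_zero fun ν _ => ?_
  by_cases h : μ = ν
  · simp [h]
  · simp only [if_neg h]
    have e : ∑ β, (((1 / 2 : ℝ) * W μ ν : ℝ) : ℂ) * (conj (curlRow ph μ ν α) * curlRow ph μ ν β) * ph β
        = (((1 / 2 : ℝ) * W μ ν : ℝ) : ℂ) * conj (curlRow ph μ ν α) * ∑ β, curlRow ph μ ν β * ph β := by
      rw [Finset.mul_sum]; exact Finset.sum_congr rfl fun β _ => by ring
    rw [e, sum_curlRow_mul]
    ring

/-- [folklore] **THE COMPLETED MATRIX ON THE PURE GAUGE**: `feynMat W ph *ᵥ ph = (Σ‖ph‖²)·ph` (the Maxwell part kills `ph`; the slice projector `ph ph†` gives `|ph|²·ph`). -/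
theorem feynMat_mulVec_self (W : Fin (d + 1) → Fin (d + 1) → ℝ) (ph : Fin (d + 1) → ℂ) :
    feynMat W ph *ᵥ ph = ((∑ β, ‖ph β‖ ^ 2 : ℝ) : ℂ) • ph := by
  have hM := maxwellMat_mulVec_self W ph
  funext α
  have hMα := congrFun hM α
  simp only [mulVec, dotProduct, Pi.zero_apply] at hMα
  simp only [mulVec, dotProduct, feynMat, add_mul, Finset.sum_add_distrib, hMα, zero_add, Pi.smul_apply, smul_eq_mul]
  have e : ∑ x, ph α * conj (ph x) * ph x = ph α * ∑ x, conj (ph x) * ph x := by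
    rw [Finset.mul_sum]; exact Finset.sum_congr rfl fun x _ => by ring
  rw [e, mul_comm]
  congr 1
  rw [Complex.ofReal_sum]
  exact Finset.sum_congr rfl fun x _ => by rw [Complex.conj_mul', Complex.ofReal_pow]

/-- [our object] **(P1) IN SYMBOLS — `P̂ p̂ = p̂∕|p̂|²`**: for `s ∈ BZ` and `ph ≠ 0`, `PinfSym s ph *ᵥ ph = (Σ‖ph‖²)⁻¹·ph`. -/
theorem PinfSym_mulVec_self {s : Fin (d + 1) → ℝ} (hs : s ∈ BZ (d + 1)) {ph : Fin (d + 1) → ℂ} (hph : ph ≠ 0) :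
    PinfSym s ph *ᵥ ph = (((∑ β, ‖ph β‖ ^ 2 : ℝ) : ℂ)⁻¹) • ph := by
  have hc : ((∑ β, ‖ph β‖ ^ 2 : ℝ) : ℂ) ≠ 0 := by
    exact_mod_cast (PerfectPropagatorBound.sum_norm_sq_pos hph).ne'
  have h1 : PinfSym s ph *ᵥ (feynMat (fun μ ν => (W166Inf μ ν (ofRealVec s)).re) ph *ᵥ ph) = ph := by
    rw [mulVec_mulVec, PinfSym_mul_feynMat hs hph, one_mulVec]
  rw [feynMat_mulVec_self, mulVec_smul] at h1
  -- `c • (P ph) = ph` ⟹ `P ph = c⁻¹ • ph`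
  have h2 := congrArg (fun w => (((∑ β, ‖ph β‖ ^ 2 : ℝ) : ℂ)⁻¹) • w) h1
  simp only [smul_smul, inv_mul_cancel₀ hc, one_smul] at h2
  exact h2

/-- [folklore] The perfect BF propagator symbol is Hermitian (inverse of the Hermitian completed matrix). -/
theorem PinfSym_isHermitian (s : Fin (d + 1) → ℝ) (ph : Fin (d + 1) → ℂ) : (PinfSym s ph).IsHermitian :=
  (feynMat_isHermitian _ ph).inv

/-- [our object] Row form of (P1): `star ph ᵥ* PinfSym s ph = (Σ‖ph‖²)⁻¹·star ph`. -/
theorem star_vecMul_PinfSym_self {s : Fin (d + 1) → ℝ} (hs : s ∈ BZ (d + 1)) {ph : Fin (d + 1) → ℂ} (hph : ph ≠ 0) :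
    star ph ᵥ* PinfSym s ph = (((∑ β, ‖ph β‖ ^ 2 : ℝ) : ℂ)⁻¹) • star ph := by
  have h := congrArg star (PinfSym_mulVec_self hs hph)
  rw [star_mulVec, (PinfSym_isHermitian s ph).eq, star_smul] at h
  rw [h]
  congr 1
  rw [Complex.star_def, map_inv₀, Complex.conj_ofReal]

/-- [folklore] For a Hermitian `F` with `F ph = c·ph` (`c` real): `star ph ⬝ᵥ (F *ᵥ w) = c·(star ph ⬝ᵥ w)`. -/
theorem dotProduct_feynMat_mulVec_self (W : Fin (d + 1) → Fin (d + 1) → ℝ) (ph w : Fin (d + 1) → ℂ) :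
    star ph ⬝ᵥ (feynMat W ph *ᵥ w) = ((∑ β, ‖ph β‖ ^ 2 : ℝ) : ℂ) * (star ph ⬝ᵥ w) := by
  rw [star_dotProduct_mulVec_hermitian (feynMat_isHermitian W ph), feynMat_mulVec_self, dotProduct_smul, smul_eq_mul, star_mul',
    star_dotProduct, star_star, Complex.star_def, Complex.conj_ofReal]

/-- [our object] **THE TRANSVERSE SPLIT IN FORM CURRENCY**: for `s ∈ BZ`, `ph ≠ 0` and every `v`,
`Re v†P̂v = maxwellQ W ph (P̂v) + ‖ph†v‖² ∕ (Σ‖ph‖²)²` (`w := P̂v`, `Fw = v`, `v†P̂v = w†Fw = maxwellQ(w) + |ph†w|²`, `ph†v = |ph|²·ph†w`). -/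
theorem re_quad_PinfSym_eq_maxwellQ_add {s : Fin (d + 1) → ℝ} (hs : s ∈ BZ (d + 1)) {ph : Fin (d + 1) → ℂ} (hph : ph ≠ 0)
    (v : Fin (d + 1) → ℂ) :
    (quad (PinfSym s ph) v).re = maxwellQ (fun μ ν => (W166Inf μ ν (ofRealVec s)).re) ph (PinfSym s ph *ᵥ v)
      + ‖star ph ⬝ᵥ v‖ ^ 2 / (∑ β, ‖ph β‖ ^ 2) ^ 2 := by
  set F := feynMat (fun μ ν => (W166Inf μ ν (ofRealVec s)).re) ph with hF
  set w := PinfSym s ph *ᵥ v with hw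
  have hFw : F *ᵥ w = v := by rw [hw, mulVec_mulVec, hF, feynMat_mul_PinfSym hs hph, one_mulVec]
  have hc : 0 < ∑ β, ‖ph β‖ ^ 2 := PerfectPropagatorBound.sum_norm_sq_pos hph
  -- `v†P̂v = w†Fw`
  have hq : (quad (PinfSym s ph) v).re = (quad F w).re := by
    rw [quad_eq_dotProduct, quad_eq_dotProduct, hFw, ← hw, star_dotProduct]
    simp only [Complex.star_def, Complex.conj_re]
  rw [hq, hF, quad_feynMat, Complex.ofReal_re]
  congr 1
  -- `‖Σ ph μ conj(w μ)‖² = ‖ph† v‖²/|ph|⁴` from `ph†v = |ph|²·ph†w`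
  have hv : star ph ⬝ᵥ v = ((∑ β, ‖ph β‖ ^ 2 : ℝ) : ℂ) * (star ph ⬝ᵥ w) := by
    rw [← hFw, hF, dotProduct_feynMat_mulVec_self]
  have hphw : ‖∑ μ, ph μ * conj (w μ)‖ = ‖star ph ⬝ᵥ w‖ := by
    have : (∑ μ, ph μ * conj (w μ)) = conj (star ph ⬝ᵥ w) := by
      rw [dotProduct, map_sum]
      exact Finset.sum_congr rfl fun μ _ => by rw [Pi.star_apply, RCLike.star_def, map_mul, Complex.conj_conj]
    rw [this, Complex.norm_conj]
  rw [hphw, hv, norm_mul, Complex.norm_real, Real.norm_eq_abs, abs_of_pos hc, mul_pow]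
  field_simp

/-- [our object] **`P̂^T ≥ 0`**: `0 ≤ Re v†P̂v − ‖ph†v‖²∕(Σ‖ph‖²)²` (the transverse part of the perfect BF propagator symbol is positive semidefinite). -/
theorem re_quad_PinfSym_sub_gauge_nonneg {s : Fin (d + 1) → ℝ} (hs : s ∈ BZ (d + 1)) {ph : Fin (d + 1) → ℂ} (hph : ph ≠ 0)
    (v : Fin (d + 1) → ℂ) : 0 ≤ (quad (PinfSym s ph) v).re - ‖star ph ⬝ᵥ v‖ ^ 2 / (∑ β, ‖ph β‖ ^ 2) ^ 2 := by
  rw [re_quad_PinfSym_eq_maxwellQ_add hs hph, add_sub_cancel_right]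
  exact maxwellQ_W166Inf_nonneg hs ph _

/-- [our object] Equivalently `Re v†P̂v ≥ ‖ph†v‖²∕(Σ‖ph‖²)²` (the pure-gauge share of the propagator form). -/
theorem re_quad_PinfSym_ge_gauge {s : Fin (d + 1) → ℝ} (hs : s ∈ BZ (d + 1)) {ph : Fin (d + 1) → ℂ} (hph : ph ≠ 0) (v : Fin (d + 1) → ℂ) :
    ‖star ph ⬝ᵥ v‖ ^ 2 / (∑ β, ‖ph β‖ ^ 2) ^ 2 ≤ (quad (PinfSym s ph) v).re := by
  have := re_quad_PinfSym_sub_gauge_nonneg hs hph v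
  linarith

/-! ## §2 (P2) in symbols: the contour weight times the fine difference symbol is the block weight times the coarse difference symbol -/

/-- [folklore] The contour weight factors as block weight × the geometric sum along the contour direction (definitional). -/
theorem cweight_eq_prod_mul (n : ℕ) (μ : Fin (d + 1)) (k : Fin (d + 1) → ℂ) : cweight n μ k = (∏ i, gsum (k i) n) * gsum (k μ) n := rfl

/-- [folklore] **(P2) IN SYMBOLS**: `cweight n μ k · (e^{ik_μ} − 1) = (Π_i gsum (k_i) n) · (e^{ik_μ·n} − 1)` (telescoping of the geometric sum, `AliasWeights.geomExp_mul_sub_one`). -/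
theorem cweight_mul_dhat (n : ℕ) (μ : Fin (d + 1)) (k : Fin (d + 1) → ℂ) :
    cweight n μ k * (cexp (I * k μ) - 1) = (∏ i, gsum (k i) n) * (cexp (I * k μ * n) - 1) := by
  rw [cweight_eq_prod_mul, mul_assoc]
  congr 1
  exact geomExp_mul_sub_one (k μ) n

/-- [folklore] At the alias momentum `k_l = (P + 2πl)∕n`: `e^{i (k_l)_μ · n} = e^{i P_μ}`. -/
theorem cexp_aliasPt_mul (n : ℕ) [NeZero n] (l : Fin (d + 1) → Fin n) (P : Fin (d + 1) → ℂ) (μ : Fin (d + 1)) :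
    cexp (I * aliasPt n l P μ * n) = cexp (I * P μ) := by
  have hn : (n : ℂ) ≠ 0 := by exact_mod_cast NeZero.ne n
  unfold aliasPt
  rw [show I * ((P μ + 2 * π * ((l μ : ℕ) : ℂ)) / n) * n = I * P μ + ((l μ : ℕ) : ℂ) * (2 * π * I) by field_simp]
  rw [Complex.exp_add, Complex.exp_nat_mul_two_pi_mul_I, mul_one]

/-- [our object] **«`Q d = d^c Q′`» ALIAS TERM BY ALIAS TERM**: `cweight n μ (k_l) · (e^{i(k_l)_μ} − 1) = (Π_i gsum ((k_l)_i) n) · (e^{iP_μ} − 1)` — the contour weight times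
the FINE difference symbol at the alias momentum equals the block-mean weight times the COARSE difference symbol. -/
theorem cweight_mul_dhat_aliasPt (n : ℕ) [NeZero n] (l : Fin (d + 1) → Fin n) (P : Fin (d + 1) → ℂ) (μ : Fin (d + 1)) :
    cweight n μ (aliasPt n l P) * (cexp (I * aliasPt n l P μ) - 1) = (∏ i, gsum (aliasPt n l P i) n) * (cexp (I * P μ) - 1) := by
  rw [cweight_mul_dhat, cexp_aliasPt_mul]

/-! ## §3 The block-mean weight at the `l = 0` alias momentum -/

/-- [folklore] **THE BLOCK-MEAN WEIGHT AT `l = 0` IS LARGE**: `(2n∕π)^{d+1} ≤ ‖Π_i gsum (k_i∕n) n‖` for `k ∈ BZ` (Jordan, `two_div_pi_mul_le_norm_geomExp`). -/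
theorem norm_prod_gsum_apt_zero_ge (n : ℕ) [NeZero n] {k : Fin (d + 1) → ℝ} (hk : k ∈ BZ (d + 1)) :
    (2 / Real.pi * n) ^ (d + 1) ≤ ‖∏ i, gsum (ofRealVec (apt n (fun _ => (0 : Fin n)) k) i) n‖ := by
  have hn1 : 1 ≤ n := Nat.pos_of_ne_zero (NeZero.ne n)
  have hki : ∀ i, |k i| ≤ π := by
    intro i
    unfold BZ at hk; rw [Set.mem_Icc] at hk
    exact abs_le.mpr ⟨hk.1 i, hk.2 i⟩
  have hg : ∀ i, 2 / Real.pi * n ≤ ‖gsum (ofRealVec (apt n (fun _ => (0 : Fin n)) k) i) n‖ := by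
    intro i
    have h := two_div_pi_mul_le_norm_geomExp (hki i) hn1
    have e : ofRealVec (apt n (fun _ => (0 : Fin n)) k) i = ((k i / n : ℝ) : ℂ) := by
      simp only [ofRealVec, CoarseCovarianceEllipticBound.apt_zero_apply]
    unfold gsum
    rw [e]
    exact h
  rw [norm_prod]
  calc (2 / Real.pi * n) ^ (d + 1) = ∏ _i : Fin (d + 1), (2 / Real.pi * n) := by simp
    _ ≤ ∏ i, ‖gsum (ofRealVec (apt n (fun _ => (0 : Fin n)) k) i) n‖ := Finset.prod_le_prod (fun _ _ => by positivity) fun i _ => hg i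

/-- [folklore] `‖Π_i gsum (q_i) n‖ ≤ n^{d+1}` at real momenta. -/
theorem norm_prod_gsum_ofReal_le (n : ℕ) (q : Fin (d + 1) → ℝ) : ‖∏ i, gsum (ofRealVec q i) n‖ ≤ (n : ℝ) ^ (d + 1) := by
  rw [norm_prod]
  calc ∏ i, ‖gsum (ofRealVec q i) n‖ ≤ ∏ _i : Fin (d + 1), (n : ℝ) := Finset.prod_le_prod (fun _ _ => norm_nonneg _) fun i _ => by
          unfold gsum; simp only [ofRealVec]; exact norm_geomExp_le (q i) n
    _ = (n : ℝ) ^ (d + 1) := by simp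

end Summit.QuantumFields.BalabanUV.Beta.FP.ResidualModeSymbols

end
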